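import Summits.Ventures.CertifiedManyBodySolver.Observables.SourcedTorusTTPrimeT0AHMEnvelope
import Literature.MathematicalPhysics.QuantumLattice.DWaveOrderParameterSemicontinuity
import Literature.MathematicalPhysics.QuantumLattice.DWaveSourceNNNHoppingEnergyDensityExists

/-!
# The thermodynamic limit of the BCS-crutch energy density EXISTS and is the Moreau envelope of the
# sourced energy density

Cell `hubbard-cq` (venture `CertifiedManyBodySolver`; card `bcs-crutch-odlro-floor`, corollary column —
lead RULING 124 (2)(c) free choice). Notation: `A_L(h) = dWaveSourceTorusTT' L t' U μ h`, `E_L(h) = E₀(A_L(h))`,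
`e = dWaveSourceEnergyDensityTT' t' U μ` (`E_L/L² → e`), `‖P‖ = 2Σ_e|d(e)/√2|`, crutch Hamiltonian with base
field `H_{g,L}(h₀) = A_L(h₀) − (g/L²)Δ_dᴴΔ_d` (`crutchTorusTT' L t' U μ g` at `h₀ = 0`).

* `abs_groundEnergy_div_sq_sub_le`, `abs_dWaveSourceEnergyDensityTT'_sub_le_source` — `E_L/L²` and `e` are
  `2‖P‖`-Lipschitz in the source (tree: `abs_groundEnergy_dWaveSourceTorusTT'_sub_le`, passed to the limit);
* **`eventually_forall_abs_groundEnergy_div_sq_sub_le`** — UNIFORM convergence `E_L(h)/L² → e(h)` on compact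
  source intervals (finite grid + equi-Lipschitz);
* **`exists_tendsto_crutchEnergyDensity`** — for `h₀ ≥ 0`, `g > 0`:
  `E₀(H_{g,L}(h₀))/L² → e_cr(g,h₀) = min_{h ∈ ℝ} [e(h) + (h − h₀)²/g] = e(h⋆) + (h⋆ − h₀)²/g`, the minimum
  attained at some `h⋆ ∈ [h₀, h₀ + 2g‖P‖ + 1]` (upper half: the easy AHM half at every `h`; lower half: the
  hard AHM half places a near-optimal field in that interval, where the convergence is uniform);
* `exists_tendsto_crutchTorusTT'_energyDensity` — the same on the card's D1 object by name (`h₀ = 0`).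

READING: the BCS crutch HAS a thermodynamic-limit ground-state energy density (grand canonical, fixed `μ`),
and it is the Moreau envelope of the sourced curve — the `T = 0` form of the Bogoliubov Jr. / Bru–de Siqueira
Pedra variational formula `p = sup_c (p̃(c) − |c|²)`; with `CrutchSusceptibility.lean`: `e(h₀) − e_cr(g,h₀) =
g·m⁺(h₀)² + o(g)`. HONEST SCOPE / WHAT THIS IS NOT: energy of the crutch Hamiltonian, not of the Hubbard model;
nothing at `g = 0` is floored; no density pinning (GC at one `μ`); no phase sentence. Everything PROVED; no
definition, no named fact; zero compute.

References: J.-B. Bru, W. de Siqueira Pedra, Mem. AMS 224 (2013), Thm 2.12 and Appendix Thm 107;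
N. N. Bogolyubov Jr. et al., Russ. Math. Surveys 39:6 (1984); R. B. Israel, *Convexity in the theory of lattice
gases* (1979), Thm I.3.4; D. Ruelle, *Statistical Mechanics* (1969), §2.4.
-/

noncomputable section

namespace Summit.Ventures.CertifiedManyBodySolver.Observables.SourcedTorusAHM

open Matrix Finset Filter Topology Set Literature.MathematicalPhysics.QuantumLattice
open Literature.Probability.LatticeModels
open scoped ComplexOrder

/-! ### Equi-Lipschitz control in the source and uniform convergence on compact source intervals -/

/-- Per-site Lipschitz bound of the finite-volume sourced energy density in the source:
`|E_L(h)/L² − E_L(h')/L²| ≤ 2‖P‖·|h − h'|`, `‖P‖ = 2Σ_e|d(e)/√2|`, uniformly in `L`. Israel (1979) Thm I.3.4. -/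
theorem abs_groundEnergy_div_sq_sub_le (L : ℕ) [NeZero L] (tp U μ h h' : ℝ) :
    |(dWaveSourceTorusTT' L tp U μ h).groundEnergy / (L : ℝ) ^ 2 -
        (dWaveSourceTorusTT' L tp U μ h').groundEnergy / (L : ℝ) ^ 2| ≤
      2 * (2 * ∑ e ∈ insert (0 : Site 2) unitSteps, |dWaveFormFactor e / Real.sqrt 2|) * |h - h'| := by
  have hV : (0 : ℝ) < (L : ℝ) ^ 2 := cast_sq_pos_of_neZero L
  have key := abs_groundEnergy_dWaveSourceTorusTT'_sub_le tp U μ L h h'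
  rw [← sub_div, abs_div, abs_of_pos hV, div_le_iff₀ hV]
  calc |(dWaveSourceTorusTT' L tp U μ h).groundEnergy - (dWaveSourceTorusTT' L tp U μ h').groundEnergy|
      ≤ 2 * ((2 * ∑ e ∈ insert (0 : Site 2) unitSteps, |dWaveFormFactor e / Real.sqrt 2|) * (L : ℝ) ^ 2) *
          |h - h'| := key
    _ = 2 * (2 * ∑ e ∈ insert (0 : Site 2) unitSteps, |dWaveFormFactor e / Real.sqrt 2|) * |h - h'| *
          (L : ℝ) ^ 2 := by ring

/-- The thermodynamic-limit sourced energy density is `2‖P‖`-Lipschitz in the source (limit of the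
finite-volume bound). Israel (1979) Thm I.3.4. -/
theorem abs_dWaveSourceEnergyDensityTT'_sub_le_source (tp U μ h h' : ℝ) :
    |dWaveSourceEnergyDensityTT' tp U μ h - dWaveSourceEnergyDensityTT' tp U μ h'| ≤
      2 * (2 * ∑ e ∈ insert (0 : Site 2) unitSteps, |dWaveFormFactor e / Real.sqrt 2|) * |h - h'| := by
  have ht := ((tendsto_dWaveSourceEnergyDensityTT' tp U μ h).sub
    (tendsto_dWaveSourceEnergyDensityTT' tp U μ h')).abs
  exact le_of_tendsto' ht fun n => abs_groundEnergy_div_sq_sub_le (n + 1) tp U μ h h'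

/-- **UNIFORM CONVERGENCE of `E_L(h)/L² → e(h)` on compact source intervals**: for `a ≤ b` and `ε > 0`,
eventually in `L`, `|E_L(h)/L² − e(h)| ≤ ε` for ALL `h ∈ [a, b]` (any reals `a, b`) (pointwise convergence on a finite grid
plus the uniform Lipschitz bound `2‖P‖`). Israel (1979) Thm I.3.4; Ruelle (1969) §2.4. -/
theorem eventually_forall_abs_groundEnergy_div_sq_sub_le (tp U μ : ℝ) (a b : ℝ) {ε : ℝ} (hε : 0 < ε) :
    ∀ᶠ n : ℕ in atTop, ∀ h : ℝ, a ≤ h → h ≤ b →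
      |(dWaveSourceTorusTT' (n + 1) tp U μ h).groundEnergy / (((n + 1 : ℕ) : ℝ)) ^ 2 -
          dWaveSourceEnergyDensityTT' tp U μ h| ≤ ε := by
  set K2 : ℝ := 2 * (2 * ∑ e ∈ insert (0 : Site 2) unitSteps, |dWaveFormFactor e / Real.sqrt 2|) with hK2
  have hK2 : 0 ≤ K2 := by positivity
  -- mesh `δ` with `2·K2·δ ≤ 2ε/3`, grid `t i = a + i δ`, `i ≤ N`
  set δ : ℝ := ε / (3 * K2 + 3) with hδ
  have hδ0 : 0 < δ := by positivity
  have hKδ : K2 * δ ≤ ε / 3 := by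
    have h3 : 0 < 3 * K2 + 3 := by positivity
    rw [hδ, mul_div_assoc', div_le_iff₀ h3]
    have e1 : ε / 3 * (3 * K2 + 3) = K2 * ε + ε := by ring
    rw [e1]
    linarith
  set N : ℕ := ⌈(b - a) / δ⌉₊ with hN
  set t : ℕ → ℝ := fun i => a + i * δ with ht
  -- pointwise convergence on the grid, all grid points at once
  have hgrid : ∀ᶠ n : ℕ in atTop, ∀ i ∈ Finset.range (N + 1),
      |(dWaveSourceTorusTT' (n + 1) tp U μ (t i)).groundEnergy / (((n + 1 : ℕ) : ℝ)) ^ 2 -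
          dWaveSourceEnergyDensityTT' tp U μ (t i)| ≤ ε / 3 := by
    refine (eventually_all_finset _).2 fun i _ => ?_
    have hc := Metric.tendsto_nhds.1 (tendsto_dWaveSourceEnergyDensityTT' tp U μ (t i)) (ε / 3) (by positivity)
    filter_upwards [hc] with n hn
    rw [Real.dist_eq] at hn
    exact hn.le
  filter_upwards [hgrid] with n hn h hah hhb
  -- the grid point below `h`
  set i : ℕ := ⌊(h - a) / δ⌋₊ with hi
  have hx0 : 0 ≤ (h - a) / δ := div_nonneg (by linarith) hδ0.le
  have hiN : i ∈ Finset.range (N + 1) := by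
    rw [Finset.mem_range, Nat.lt_succ_iff, hi, hN]
    exact (Nat.floor_le_floor (div_le_div_of_nonneg_right (by linarith) hδ0.le)).trans (Nat.floor_le_ceil _)
  have hti1 : t i ≤ h := by
    have := Nat.floor_le hx0
    rw [ht]
    dsimp only
    rw [hi]
    have : (⌊(h - a) / δ⌋₊ : ℝ) * δ ≤ (h - a) / δ * δ := mul_le_mul_of_nonneg_right this hδ0.le
    rw [div_mul_cancel₀ _ hδ0.ne'] at this
    linarith
  have hti2 : h - t i ≤ δ := by
    have := Nat.lt_floor_add_one ((h - a) / δ)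
    rw [ht]
    dsimp only
    rw [hi]
    have h2 : (h - a) / δ * δ ≤ ((⌊(h - a) / δ⌋₊ : ℝ) + 1) * δ := mul_le_mul_of_nonneg_right this.le hδ0.le
    rw [div_mul_cancel₀ _ hδ0.ne'] at h2
    linarith
  have habs : |h - t i| ≤ δ := by rw [abs_of_nonneg (by linarith)]; exact hti2
  -- triangle inequality
  have h1 := abs_groundEnergy_div_sq_sub_le (n + 1) tp U μ h (t i)
  have h2 := hn i hiN
  have h3 := abs_dWaveSourceEnergyDensityTT'_sub_le_source tp U μ (t i) h
  rw [abs_sub_comm (t i) h] at h3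
  have hK2δ : K2 * |h - t i| ≤ ε / 3 := (mul_le_mul_of_nonneg_left habs hK2).trans hKδ
  calc |(dWaveSourceTorusTT' (n + 1) tp U μ h).groundEnergy / (((n + 1 : ℕ) : ℝ)) ^ 2 -
          dWaveSourceEnergyDensityTT' tp U μ h|
      ≤ |(dWaveSourceTorusTT' (n + 1) tp U μ h).groundEnergy / (((n + 1 : ℕ) : ℝ)) ^ 2 -
            (dWaveSourceTorusTT' (n + 1) tp U μ (t i)).groundEnergy / (((n + 1 : ℕ) : ℝ)) ^ 2| +
          |(dWaveSourceTorusTT' (n + 1) tp U μ (t i)).groundEnergy / (((n + 1 : ℕ) : ℝ)) ^ 2 -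
            dWaveSourceEnergyDensityTT' tp U μ (t i)| +
          |dWaveSourceEnergyDensityTT' tp U μ (t i) - dWaveSourceEnergyDensityTT' tp U μ h| := by
        exact (abs_sub_le _ _ _).trans (add_le_add (abs_sub_le _ _ _) le_rfl)
    _ ≤ ε / 3 + ε / 3 + ε / 3 := add_le_add (add_le_add (h1.trans hK2δ) h2) (h3.trans hK2δ)
    _ = ε := by ring


/-! ### The crutch energy density in the thermodynamic limit: existence and the Moreau envelope -/

/-- **THE THERMODYNAMIC LIMIT OF THE BCS-CRUTCH GROUND-STATE ENERGY DENSITY EXISTS AND IS THE MOREAU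
ENVELOPE OF THE SOURCED ENERGY DENSITY.** For `h₀ ≥ 0` and `g > 0` there are `e_cr` and a field
`h⋆ ∈ [h₀, h₀ + 2g‖P‖ + 1]` with
`E₀(A_L(h₀) − (g/L²)Δ_dᴴΔ_d)/L² → e_cr = e(h⋆) + (h⋆ − h₀)²/g = min_{h ∈ ℝ} [e(h) + (h − h₀)²/g]`
(`e = dWaveSourceEnergyDensityTT' t' U μ`, the limit along the sides `L = n + 1`). Upper half: the easy
half at every fixed `h` and `E_L(h)/L² → e(h)`; lower half: the hard half places a near-optimal field
`h_L ∈ [h₀, h₀ + 2g‖P‖ + √(gε)]` (`ahmTT'_groundEnergy_bound`, `ahmTT'_abs_sub_le_of_bound`) and `E_L/L² → e`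
UNIFORMLY there (`eventually_forall_abs_groundEnergy_div_sq_sub_le`); the minimum over the compact interval
exists by continuity of `e`. This is the `T = 0` form of the Bogoliubov Jr. / Bru–de Siqueira Pedra variational
formula `p = sup_c (p̃(c) − |c|²)` for the BCS crutch: the crutch has a thermodynamic-limit energy density and it
is a functional of the sourced curve `e` alone. Bru–de Siqueira Pedra (2013) Thm 2.12 / Appendix Thm 107;
Koma–Tasaki (1994) §1. -/
theorem exists_tendsto_crutchEnergyDensity (tp U μ : ℝ) {h₀ g : ℝ} (hh₀ : 0 ≤ h₀) (hg : 0 < g) :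
    ∃ e_cr h_opt : ℝ, h₀ ≤ h_opt ∧
      h_opt ≤ h₀ + 2 * g * (2 * ∑ e ∈ insert (0 : Site 2) unitSteps, |dWaveFormFactor e / Real.sqrt 2|) + 1 ∧
      e_cr = dWaveSourceEnergyDensityTT' tp U μ h_opt + (h_opt - h₀) ^ 2 / g ∧
      (∀ h : ℝ, e_cr ≤ dWaveSourceEnergyDensityTT' tp U μ h + (h - h₀) ^ 2 / g) ∧
      Tendsto (fun n : ℕ =>
        (dWaveSourceTorusTT' (n + 1) tp U μ h₀ - ((g / (((n + 1 : ℕ) : ℝ)) ^ 2 : ℝ) : ℂ) •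
            ((pairField dWaveFormFactor (n + 1))ᴴ * pairField dWaveFormFactor (n + 1))).groundEnergy /
          (((n + 1 : ℕ) : ℝ)) ^ 2) atTop (𝓝 e_cr) := by
  set K : ℝ := 2 * ∑ e ∈ insert (0 : Site 2) unitSteps, |dWaveFormFactor e / Real.sqrt 2| with hK
  have hK0 : 0 ≤ K := by positivity
  set φ : ℝ → ℝ := fun h => dWaveSourceEnergyDensityTT' tp U μ h + (h - h₀) ^ 2 / g with hφ
  have hφc : Continuous φ := (continuous_dWaveSourceEnergyDensityTT'_source tp U μ).add (by fun_prop)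
  -- the minimiser over the compact interval `I = [h₀, h₀ + 2gK + 1]`
  have hI : IsCompact (Icc h₀ (h₀ + 2 * g * K + 1)) := isCompact_Icc
  have hIne : (Icc h₀ (h₀ + 2 * g * K + 1)).Nonempty := nonempty_Icc.2 (by nlinarith)
  obtain ⟨hs, hsI, hsmin⟩ := hI.exists_isMinOn hIne hφc.continuousOn
  -- the crutch energy densities
  set u : ℕ → ℝ := fun n =>
    (dWaveSourceTorusTT' (n + 1) tp U μ h₀ - ((g / (((n + 1 : ℕ) : ℝ)) ^ 2 : ℝ) : ℂ) •
        ((pairField dWaveFormFactor (n + 1))ᴴ * pairField dWaveFormFactor (n + 1))).groundEnergy /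
      (((n + 1 : ℕ) : ℝ)) ^ 2 with hu
  -- UPPER: for every `h`, eventually `u n ≤ φ h + δ`
  have hupper : ∀ h : ℝ, ∀ δ : ℝ, 0 < δ → ∀ᶠ n : ℕ in atTop, u n ≤ φ h + δ := by
    intro h δ hδ
    have hc := Metric.tendsto_nhds.1 (tendsto_dWaveSourceEnergyDensityTT' tp U μ h) δ hδ
    filter_upwards [hc] with n hn
    rw [Real.dist_eq] at hn
    have hV : (0 : ℝ) < (((n + 1 : ℕ) : ℝ)) ^ 2 := by positivity
    have heasy := div_le_div_of_nonneg_right (ahmTT'_groundEnergy_model_le (n + 1) tp U μ h₀ h hg) hV.le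
    have e1 : ((dWaveSourceTorusTT' (n + 1) tp U μ h).groundEnergy +
          (h - h₀) ^ 2 * (((n + 1 : ℕ) : ℝ)) ^ 2 / g) / (((n + 1 : ℕ) : ℝ)) ^ 2 =
        (dWaveSourceTorusTT' (n + 1) tp U μ h).groundEnergy / (((n + 1 : ℕ) : ℝ)) ^ 2 + (h - h₀) ^ 2 / g := by
      field_simp
    rw [e1] at heasy
    have hlt := (abs_lt.1 hn).2
    show (dWaveSourceTorusTT' (n + 1) tp U μ h₀ - ((g / (((n + 1 : ℕ) : ℝ)) ^ 2 : ℝ) : ℂ) •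
          ((pairField dWaveFormFactor (n + 1))ᴴ * pairField dWaveFormFactor (n + 1))).groundEnergy /
        (((n + 1 : ℕ) : ℝ)) ^ 2 ≤ dWaveSourceEnergyDensityTT' tp U μ h + (h - h₀) ^ 2 / g + δ
    linarith
  -- LOWER: eventually `u n ≥ φ hs − δ`
  have hlower : ∀ δ : ℝ, 0 < δ → ∀ᶠ n : ℕ in atTop, φ hs - δ ≤ u n := by
    intro δ hδ
    -- accuracy of the hard half: `ε' ≤ δ/2` and `√(g ε') ≤ 1`
    set ε' : ℝ := min (δ / 2) (1 / g) with hε'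
    have hε'0 : 0 < ε' := lt_min (by positivity) (by positivity)
    have hε'δ : ε' ≤ δ / 2 := min_le_left _ _
    have hε'g : Real.sqrt (g * ε') ≤ 1 := by
      have h1 : g * ε' ≤ 1 := by
        have := min_le_right (δ / 2) (1 / g)
        rw [← hε'] at this
        calc g * ε' ≤ g * (1 / g) := mul_le_mul_of_nonneg_left this hg.le
          _ = 1 := by field_simp
      calc Real.sqrt (g * ε') ≤ Real.sqrt 1 := Real.sqrt_le_sqrt h1
        _ = 1 := Real.sqrt_one
    obtain ⟨L₀, hL₀⟩ := ahmTT'_groundEnergy_bound tp U g |μ| h₀ ε' hg hε'0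
    have hunif := eventually_forall_abs_groundEnergy_div_sq_sub_le tp U μ h₀ (h₀ + 2 * g * K + 1)
      (ε := δ / 2) (by positivity)
    filter_upwards [hunif, eventually_ge_atTop L₀] with n hn hnL
    obtain ⟨h, hh, hb⟩ := hL₀ (n + 1) (by omega) μ le_rfl h₀ hh₀ le_rfl
    have hloc := ahmTT'_abs_sub_le_of_bound (n + 1) tp U μ h₀ h hg hε'0.le hb
    rw [abs_of_nonneg (sub_nonneg.2 hh)] at hloc
    have hmem : h ∈ Icc h₀ (h₀ + 2 * g * K + 1) := ⟨hh, by linarith⟩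
    have hmin : φ hs ≤ φ h := hsmin hmem
    have hV : (0 : ℝ) < (((n + 1 : ℕ) : ℝ)) ^ 2 := by positivity
    have hb' := div_le_div_of_nonneg_right hb hV.le
    have e1 : ((dWaveSourceTorusTT' (n + 1) tp U μ h).groundEnergy +
          (h - h₀) ^ 2 * (((n + 1 : ℕ) : ℝ)) ^ 2 / g) / (((n + 1 : ℕ) : ℝ)) ^ 2 =
        (dWaveSourceTorusTT' (n + 1) tp U μ h).groundEnergy / (((n + 1 : ℕ) : ℝ)) ^ 2 + (h - h₀) ^ 2 / g := by
      field_simp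
    have e2 : ((dWaveSourceTorusTT' (n + 1) tp U μ h₀ - ((g / (((n + 1 : ℕ) : ℝ)) ^ 2 : ℝ) : ℂ) •
          ((pairField dWaveFormFactor (n + 1))ᴴ * pairField dWaveFormFactor (n + 1))).groundEnergy +
          ε' * (((n + 1 : ℕ) : ℝ)) ^ 2) / (((n + 1 : ℕ) : ℝ)) ^ 2 =
        (dWaveSourceTorusTT' (n + 1) tp U μ h₀ - ((g / (((n + 1 : ℕ) : ℝ)) ^ 2 : ℝ) : ℂ) •
          ((pairField dWaveFormFactor (n + 1))ᴴ * pairField dWaveFormFactor (n + 1))).groundEnergy /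
          (((n + 1 : ℕ) : ℝ)) ^ 2 + ε' := by
      field_simp
    rw [e1, e2] at hb'
    have hun := hn h hh (by linarith)
    have hge := (abs_le.1 hun).1
    have hmin' : dWaveSourceEnergyDensityTT' tp U μ hs + (hs - h₀) ^ 2 / g ≤
        dWaveSourceEnergyDensityTT' tp U μ h + (h - h₀) ^ 2 / g := hmin
    show dWaveSourceEnergyDensityTT' tp U μ hs + (hs - h₀) ^ 2 / g - δ ≤
      (dWaveSourceTorusTT' (n + 1) tp U μ h₀ - ((g / (((n + 1 : ℕ) : ℝ)) ^ 2 : ℝ) : ℂ) •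
          ((pairField dWaveFormFactor (n + 1))ᴴ * pairField dWaveFormFactor (n + 1))).groundEnergy /
        (((n + 1 : ℕ) : ℝ)) ^ 2
    linarith
  -- conclude: `u n → φ hs`
  refine ⟨φ hs, hs, hsI.1, hsI.2, rfl, fun h => ?_, ?_⟩
  · -- `φ hs ≤ φ h` for every real `h`: pass to the limit in `φ hs − δ ≤ u n ≤ φ h + δ`
    refine le_of_forall_pos_le_add fun δ hδ => ?_
    obtain ⟨n, hn⟩ := ((hlower (δ / 2) (by positivity)).and (hupper h (δ / 2) (by positivity))).exists
    linarith [hn.1, hn.2]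
  · refine Metric.tendsto_nhds.2 fun δ hδ => ?_
    filter_upwards [hlower (δ / 2) (by positivity), hupper hs (δ / 2) (by positivity)] with n h1 h2
    rw [Real.dist_eq, abs_lt]
    constructor <;> linarith

/-- **The same on the card's D1 object by name** (`crutchTorusTT'`, `h₀ = 0`): the BCS-crutch ground-state
energy density `E₀(crutchTorusTT' L t' U μ g)/L²` CONVERGES in the thermodynamic limit, to
`min_h [e(h) + h²/g]`, attained at some `h⋆ ∈ [0, 2g‖P‖ + 1]`. Bru–de Siqueira Pedra (2013) Thm 2.12. -/
theorem exists_tendsto_crutchTorusTT'_energyDensity (tp U μ : ℝ) {g : ℝ} (hg : 0 < g) :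
    ∃ e_cr h_opt : ℝ, 0 ≤ h_opt ∧
      h_opt ≤ 2 * g * (2 * ∑ e ∈ insert (0 : Site 2) unitSteps, |dWaveFormFactor e / Real.sqrt 2|) + 1 ∧
      e_cr = dWaveSourceEnergyDensityTT' tp U μ h_opt + h_opt ^ 2 / g ∧
      (∀ h : ℝ, e_cr ≤ dWaveSourceEnergyDensityTT' tp U μ h + h ^ 2 / g) ∧
      Tendsto (fun n : ℕ => (crutchTorusTT' (n + 1) tp U μ g).groundEnergy / (((n + 1 : ℕ) : ℝ)) ^ 2)
        atTop (𝓝 e_cr) := by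
  obtain ⟨e, hopt, h1, h2, h3, h4, h5⟩ := exists_tendsto_crutchEnergyDensity tp U μ (h₀ := 0) le_rfl hg
  refine ⟨e, hopt, h1, by simpa using h2, by simpa using h3, fun h => by simpa using h4 h, ?_⟩
  refine h5.congr fun n => ?_
  rw [crutchTorusTT'_eq_model]

end Summit.Ventures.CertifiedManyBodySolver.Observables.SourcedTorusAHM

end
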